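import Literature.MathematicalPhysics.QuantumFieldTheory.Balaban1983to89.Beta.BubbleTable
import Literature.MathematicalPhysics.QuantumFieldTheory.Balaban1983to89.Beta.TwoPowerLegs
import Literature.MathematicalPhysics.QuantumFieldTheory.Balaban1983to89.Beta.ColourTrace

/-!
# `Balaban1983to89.Beta.GhostTable` — THE GHOST-SECTOR ONE-LOOP LEG TABLE, DERIVED FROM THE LATTICE OPERATOR: the
background vertex of the lattice adjoint covariant Laplacian `D_U*D_U` at one bond IS a `BubbleTable` stencil (the
antisymmetric lattice current), its bubble through a translation-invariant colour-diagonal propagator IS — by an2's table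
theorem `BubbleTable.bubble_stencil_eq_table`, instantiated here for the first time — four products of two legs, which the
UNIT-CELL IDENTITY regroups into the degree-6 table `g·∇_μ∇_νg − ∇_μg·∇_νg`; on `ℤ⁴` with the free legs `latticeGreen/2`
this is a `BubbleTransfer` leg table over EXISTING unconditional legs (`TwoPowerLegs`), its continuum bubble is
`trace(A·A′)·c₄²·scalarBubble_{μν}` and its (1.22)-moment is `leadingIntegrand (trace(A·A′)·c₄²/3)`; at the dictionary value
`trace(A·A′) = 2N²` the constant is `kappaBal N/11` — the ghost's `(1/3)/(11/3)` share of the coefficient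
(β sub-cell, row BETA-an3 gen 6, node BETA-an3-g6-GHOSTTABLE; BETA-SPEC v1.9r §7.20 (T) row «hdeg, hval ((W1)₀)», located
residual «covariant table for the ACTUAL Hessian vertices»; AN2.md v0.11.2 §8.9 (H1g-val) = «an3's value question for the ghost
loop»; companion of `Beta.BubbleTable` (an2) / `Beta.BubbleTransfer`, `Beta.TwoPowerLegs` (an3))

HONEST FRAMING (cell rule, verbatim): discharging `BetaPertH` makes Bałaban's UV stability UNCONDITIONAL — a real
constructive-QFT result; it is NOT the continuum limit and NOT the Clay problem.  (Gloss, BETA-SPEC v1.8d/v1.9b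
l. 17–18, GAPS G-ref2-14 (a) / G-ref2-20 (a), verbatim: «UNCONDITIONAL» in [Balaban1989LargeFieldII] (B16) p. 355's
interval-hypothesis sense ONLY (`FlowStepRuns.p355Unconditional_of_partialSums` keeps `hnodes`); the located leaves
G-adv3-2 (left inequality of (0.1)/(2.50), d = 4), G-adv3-1 (U2 transfer of B14 Cor. 3's lower bound) and `SecondExpLeaf`
REMAIN.  Gloss 2, BETA-SPEC v1.9e, beta-ref C-beta-78, BINDING: «unconditional» = `Beta.Assembly.EventualForm`-unconditional END
statement, NOT «Theorem 2 as printed»; Gloss 3″, BETA-SPEC v1.9r §7.20 (c), BINDING: on the primary road «unconditional» =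
the interval hypothesis of [B12] Thm 2 p. 259 REPLACED by the (R10-1′) partial-sums carrier, END statements under the
explicit γ-smallness restrictions of the kernel binders; never Thm 2 as printed, never continuum / mass gap / Clay.)  THIS
MODULE DISCHARGES NOTHING of the series and instantiates NO binder of the wall for Bałaban's SU(2)/SU(N) one-forms.  It
KERNEL-CHECKS: (i) noncommutative polynomial algebra deriving the first- and second-order background vertices of an
explicitly polynomial operator family; (ii) the instantiation of an2's table theorem for that vertex; (iii) a four-point
identity valid for every real function on an additive group; (iv) on `ℤ⁴`, identities between an3's existing legs,
bubbles and constants.  Value = kernel certificate (audit cell `pub-balaban`, β sub-cell, unit `b2b-balaban-beta-an3-g6`),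
NOT summit progress.

WHAT IS DERIVED AND WHAT IS DICTIONARY (ABSOLUTE RULE: no internally-minted statement enters as a cited fact; every
hypothesis below is an explicit binder; every declaration is `[folklore]`).
* DERIVED (§1). On a finite set of sites `Λ` (an additive commutative group: a torus) with colour / internal space `C`, the
  colour-diagonal forward difference along a lattice vector `e`, `(D_e λ)(y) = λ(y + e) − λ(y)`, is the matrix
  `fwdDiff e = Σ_y (E_{y,y+e} ⊗ 1 − E_{y,y} ⊗ 1)` (`BubbleTable.elemIns`).  TWISTING THE ONE BOND `(x, x+e)` by a colour matrix
  `A` to first order — transporter `1 + t·A` on that bond — gives the family `twistedDiff x e A t = fwdDiff e + t·(E_{x,x+e} ⊗ A)`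
  and the bond-Laplacian family `lapFamily x e A R t = (twistedDiff …)ᵀ·(twistedDiff …) + R` (`R` = every other bond and
  direction, `t`-independent).  THEOREM `lapFamily_expand`: `lapFamily t = lapFamily 0 + t·vertex₁ + t²·vertex₂` EXACTLY, with
  `vertex₁ = E_{x+e,x+e}⊗A − E_{x,x+e}⊗A + E_{x+e,x+e}⊗Aᵀ − E_{x+e,x}⊗Aᵀ` (`vertex₁_eq`) and the CONTACT `vertex₂ = E_{x+e,x+e}⊗(AᵀA)`
  (`vertex₂_eq`).  For SKEW `A` (`Aᵀ = −A`: the adjoint action `Y ↦ [X, Y]` of a Lie-algebra element is skew for the invariant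
  form — the case of the small-field representation «U_k = exp iηH» of [Balaban1987RG1] (INDEX B12) p. 258, CONTEXT) the first vertex is the
  ANTISYMMETRIC LATTICE CURRENT `current x e A = E_{x+e,x}⊗A − E_{x,x+e}⊗A` (`vertex₁_eq_current`), a two-entry
  `BubbleTable.stencilIns` (`current_eq_stencil`).  Two twists on DISTINCT bonds of the same direction have NO cross term
  (`lapFamily₂_expand`: the `st`-coefficient vanishes, `cross_eq_zero`); bonds of different directions sit in different
  summands of `Σ_μ D_μᵀD_μ`, so their cross term is zero trivially: the MIXED (`μ ≠ ν`) second background derivative of the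
  ghost `log det` is PURE BUBBLE, no contact table (an2's `BubbleTable.polarization` with `V₂ = 0`).  The honest modelling
  step: `1 + tA` is the FIRST JET of the bond transporter; higher jets of `exp` change `vertex₂` (contact) only, never
  `vertex₁` — and only `vertex₁` enters the bubble.  an2's `BackgroundVertices` (p180255) holds the exact jets of the
  covariant DIFFERENCE with the `η`-cancellation; this module needs only the first.
* DERIVED (§2). `bubble_current`: for `G = convKernel g` (translation-invariant, colour-diagonal — the `U = 1`, `a = 0`
  propagator shape) `trace (G·current z e A·(G·current (z+w) e′ A′)) = trace(A·A′)·[g(e−w)g(w+e′) − g(e−e′−w)g(w) −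
  g(−w)g(w+e′−e) + g(−e′−w)g(w−e)]` — an2's `bubble_stencil_eq_table` with `σ = Bool`; for EVEN `g`,
  `= 2·trace(A·A′)·(g(w−e)g(w+e′) − g(w)g(w+e′−e))` (`bubble_current_even`).
* DERIVED (§3, any additive commutative group, no finiteness). THE UNIT-CELL IDENTITY `cell_identity`:
  `g(v)g(v+e′+e) − g(v+e)g(v+e′) = g(v)·D(v) − F_e(v)·F_{e′}(v)` with the forward mixed difference
  `D(v) = g(v+e′+e) − g(v+e′) − g(v+e) + g(v)` (`mixedDiffFun`) and forward differences `F_e(v) = g(v+e) − g(v)` (`fwdDiffFun`) —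
  the DIFFERENCE MECHANISM of `BubbleTable` §5 with NO Ward input (the current's two coefficients `+A, −A` already sum to
  zero): raw degrees `(2,2)` become `2 + 4` and `3 + 3` = 6.  With `w = v + e` the even-form bracket of §2 IS the cell form at
  the corner `v` (`bubble_current_cell`): the natural OFFSET of the ghost table is `v = (base of the ν-bond) − (head of the
  μ-bond)`; the Hessian symmetry `(μ, z) ↔ (ν, z′)` is the cell's point reflection (`cell_reflect`).
* DERIVED (§4, `ℤ⁴`). With `g = latticeGreen/2` (the massless lattice propagator `(−Δ_{ℤ⁴})⁻¹(0,·)` in the tree normalisation,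
  `BubbleTransfer.freeLeg`) the cell form is the `BubbleTransfer` leg table `ghostTable`: index `Bool`, coefficients `(2τ, −2τ)`,
  legs `(TwoPowerLegs.free.baseLeg, freeMixedLeg)` and `(free.fwdLeg μ, free.fwdLeg ν)` — ALL UNCONDITIONAL tree legs (Lawler–Limic
  Thm 4.3.1 / lit1-g5's sharp differences through the tree; nothing new is assumed): `lattBubble_ghost` (the table IS the cell
  form), `hdeg_ghost` (degrees `2+4 = 3+3 = 6`), `contBubble_ghost` (`= τ·c₄²·scalarBubble μ ν`, via
  `BubbleTransfer.hessInvQuartic_eq_legs`), `hval_ghost` (`x_μx_ν·contBubble = leadingIntegrand (τ·c₄²/3) μ ν x`, `μ ≠ ν`, via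
  `scalarBubble_eq` = `T/3` and `TransverseLink.smul_moment_eq_leadingIntegrand`) — the `hdeg`/`hval` SHAPE of
  `ComposedRoad.oneLoopDrift_of_composedLegInterfacePow_identity` for this one sector, constant `τc₄²/3` in place of `kappaBal N`.
* DICTIONARY (§5, labelled, NOT derived here). `τ = trace(A·A′)` summed over the colour pairing is `(adjoint Casimir N) ×
  (B12's normalisation 2N and sign)` = `2N²` under AN3.md §6.5 (D3)/(D4) (the lineage's dictionary, B12 = [Balaban1987RG1] p. 264 (1.20)–(1.22) quoted
  there) — EXACTLY the factor `2N·N` of `BubbleTransfer.piBal`/`piOmega`; at `τ = 2N²`: `kappa_ghost_eq` (`2N²·c₄²/3 = kappaBal N/11`),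
  `piBal_ghost_part` (the ghost summand `2N·(N·c₄²·ghostBubble)` of `piBal` is `(kappaBal N/11)·T`), `hval_ghost_bal`.  SECTOR
  ADDITIVITY (`contBubble_union`, `hval_of_sectors`, `kappaBal_sectors`): `hval` constants ADD over disjoint tables, so the wall's
  `(W1)₀` constant `kappaBal N` is `kappaBal N/11` (this table) `+ 10·kappaBal N/11` (the GLUON sector: vector legs, the spin
  vertex, the Wilson-plaquette Hessian stencils — NOT in this module; BETA-SPEC v1.9r G-beta-21 «DICT-B5-VECTOR»).
* DERIVED (§6, v1.1). `lapFamilyJ_expand`/`lapFamilyJ_linear`: with an ARBITRARY second jet `B` of the bond transporter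
  (`1 + tA + t²B`, e.g. `B = A²/2` for `exp`) the expansion is `K(0) + t·vertex₁(A) + t²·(vertex₂(A) + vertex₁(B)) + t³·jetCross + t⁴·vertex₂(B)`:
  the LINEAR coefficient — the only one entering the bubble — is `vertex₁ x e A` whatever the higher jets are (JET-INDEPENDENCE; the
  first-jet modelling step of §1 costs nothing for the bubble).
* DERIVED (§7, v1.1). VECTOR COPIES: `copies D A = A ⊗ 1_D` (`Matrix.blockDiagonal`), `copies_skew`, `trace_copies_mul`
  (`trace((A⊗1)(A′⊗1)) = card D·trace(AA′)`), `bubble_current_copies(_cell)`: the vector-Laplacian («diamagnetic») sector `⊕_ν D_U*D_U` of the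
  gluon Hessian has the SAME current and the SAME table with trace factor `d` — the module is generic in the internal space.  The spin
  («paramagnetic») vertex and the exact plaquette jets are NOT here (an2 (I2-b)); the loop-statistics weights (ghost `det^{+1}`, vector
  `det^{-1/2}`) are DICTIONARY.
* DERIVED (§8, v1.1; B12's group `SU(2)`). `pauli`, `pauli_orthonormal` (`½Tr(σ^aσ^b) = δ^{ab}`: the `(1/N)Tr`-orthonormal basis of AN3 §6.5 (D4)
  IS `σ^a` at `N = 2`), `pauli_comm` (`[σ^a, σ^b] = 2i·Σ_c ε_{abc}σ^c`, kernel-checked), `adPauli a` = the real `3 × 3` matrix of `i·ad(σ^a)`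
  (`adPauli_spec`), `adPauli_transpose` (skew ⟹ `vertex₁_adPauli`: the `su(2)` ghost bond vertex IS the current, no hypothesis left),
  `trace_adPauli_mul` (`= −8δ_{ab} = −2N²δ_{ab}|_{N=2}`), `polarization_ghost_su2(_offdiag)` (`−bubble = 16·cellForm`, colour-diagonal),
  `lattBubble_ghost_su2`, `hval_ghost_su2` (`κ = kappaBal 2/11` with `τ = −trace(A_aA_a)` COMPUTED): at `N = 2` the colour factor of the
  dictionary is no longer a label.  What REMAINS labelled: the orientation reading (D3) (`Π^{Bal} = −Hess_B Ω`, i.e. the overall `−bubble`,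
  matching an2's `BubbleTable.polarization = contact − bubble`) and the identification of B12's components `B^a` with the Pauli basis.
* NOT TOUCHED (located, by name): the `Q′(U)`-transport vertices of Bałaban's ghost operator `Δ′_a = Δ_U + Q′*aQ′` ([Balaban1985BackgroundPropagators] (INDEX B9) (3.121)–(3.122) pp. 419–420,
  an2's `TransportVertices`; unit-scale stencils); the `a`-term / Woodbury correction of the legs (`(W2′)₀`, an5's
  `WoodburyFibre`/`WoodburyCovariant`); the torus ↔ `ℤ⁴` matching of `g` (AN2 (v1₀)); the gluon sector; the window / (1.22)
  bookkeeping under the bounded offset relabelling `w = v + e_μ` ((O1)-type boundary effect, an2/an4); every `k ≥ 1` object.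
  The `w`-labelled form of the table needs a backward–forward mixed leg (not in the tree) — successor item; the corner form
  needs none.

Sources.  [Balaban1987RG1] T. Bałaban, Renormalization group approach to lattice gauge field theories. I, Comm. Math. Phys.
109 (1987) 249–301 (INDEX B12) — p. 258 («U_k = exp iηH modulo a gauge transformation», the background representation the
model transporter linearises) and p. 264 (1.20)–(1.22) (the moment whose shape `hval` serves): CONTEXT ONLY; nothing of it is used.
[Balaban1985BackgroundPropagators] T. Bałaban, Propagators for lattice gauge theories in a background field, Comm. Math. Phys. 99
(1985) 389–434 (INDEX B9) — (3.121)–(3.122) pp. 419–420 (the gauge-fixed fluctuation integral with the `a‖Q′λ‖²` term, whose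
`Δ_U` part the model operator of §1 is; AN2.md §8.6): CONTEXT ONLY (which operator the model vertex belongs to); nothing of it is
used.  (v1/v1.1 of this header carried the placeholder keys `Balaban1987RT1`/`Balaban1988RT2` with wrong page locators — corrected
here per REFEREE6 E88 A2; docstring-only change.)  [DunneRius1992] eq. (14): the SUM `11/3` only — the split
`10/3 + 1/3` is textbook bookkeeping transcribed in `BubbleTransfer.gluonBubble/ghostBubble`; THIS module DERIVES the `1/3`
sector's TABLE from the lattice operator instead of transcribing it.  [Lawler1991]/[LawlerLimic2010]: enter ONLY through the
tree legs of `TwoPowerLegs` §5.  Internal division of labour (NOT citations): BETA-SPEC v1.9r §7.20; AN2.md v0.11.2 §8.6/§8.9;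
AN3.md v5.3 §6.5.

Tags: [folklore] = elementary algebra / real analysis proved here, or a definition asserting nothing.  No `axiom`, no
`sorry`.  v1.1 = v1 (p181981) + §§6–8 appended; every v1 declaration byte-identical.  v1.2 = v1.1 (p182068) + DOCFIX of the
context locators (REFEREE6 E88 A1/A2); no declaration changed.  v1.3 = v1.2 (p182096) + §9 appended (general `N` via
`Beta.ColourTrace`, import added); every v1.2 declaration byte-identical.  Imports: `Beta.BubbleTable` (an2: `elemIns`, `convKernel`, `stencilIns`, the table theorem), `Beta.TwoPowerLegs`
(an3: the free legs; transitively `BubbleTransfer`, `TransverseLink`, `LeadingCoefficient`) and `Beta.ColourTrace` (lit1: the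
adjoint-action matrices `adMat`, their skewness and trace form).
-/

noncomputable section

namespace Literature.MathematicalPhysics.QuantumFieldTheory.Balaban1983to89.Beta.GhostTable

open Finset Matrix
open scoped BigOperators
open Literature.Probability.LatticeModels (latticeGreen)
open Literature.MathematicalPhysics.QuantumFieldTheory.Balaban1983to89
open Literature.MathematicalPhysics.QuantumFieldTheory.Balaban1983to89.Beta
open Literature.MathematicalPhysics.QuantumFieldTheory.Balaban1983to89.Beta.BubbleTable
open Literature.MathematicalPhysics.QuantumFieldTheory.Balaban1983to89.Beta.BubbleTransfer
open Literature.MathematicalPhysics.QuantumFieldTheory.Balaban1983to89.Beta.TwoPowerLegs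
open Literature.MathematicalPhysics.QuantumFieldTheory.Balaban1983to89.Beta.TransverseStructure
open Literature.MathematicalPhysics.QuantumFieldTheory.Balaban1983to89.Beta.TransverseLink
open Literature.MathematicalPhysics.QuantumFieldTheory.Balaban1983to89.Beta.LeadingCoefficient
open Literature.MathematicalPhysics.QuantumFieldTheory.Balaban1983to89.Beta.DyadicShell (Pt toReal supNorm)

/-! ## §0 Elementary-insertion algebra (linearity, transpose, products) -/

section ElemIns

variable {Λ : Type*} [Fintype Λ] [DecidableEq Λ] {C : Type*} [Fintype C] [DecidableEq C]

omit [Fintype Λ] [Fintype C] [DecidableEq C] in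
/-- `E_{x,y} ⊗ (m + m′) = E_{x,y} ⊗ m + E_{x,y} ⊗ m′`. [folklore] -/
theorem elemIns_add (x y : Λ) (m m' : Matrix C C ℝ) : elemIns x y (m + m') = elemIns x y m + elemIns x y m' := by
  ext ⟨u, a⟩ ⟨v, b⟩
  simp only [elemIns_apply, Matrix.add_apply]
  split_ifs <;> simp

omit [Fintype Λ] [Fintype C] [DecidableEq C] in
/-- `E_{x,y} ⊗ (−m) = −(E_{x,y} ⊗ m)`. [folklore] -/
theorem elemIns_neg (x y : Λ) (m : Matrix C C ℝ) : elemIns x y (-m) = -elemIns x y m := by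
  ext ⟨u, a⟩ ⟨v, b⟩
  simp only [elemIns_apply, Matrix.neg_apply]
  split_ifs <;> simp

omit [Fintype Λ] [Fintype C] [DecidableEq C] in
/-- `E_{x,y} ⊗ (m − m′) = E_{x,y} ⊗ m − E_{x,y} ⊗ m′`. [folklore] -/
theorem elemIns_sub (x y : Λ) (m m' : Matrix C C ℝ) : elemIns x y (m - m') = elemIns x y m - elemIns x y m' := by
  rw [sub_eq_add_neg, elemIns_add, elemIns_neg, ← sub_eq_add_neg]

omit [Fintype Λ] [Fintype C] [DecidableEq C] in
/-- `E_{x,y} ⊗ 0 = 0`. [folklore] -/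
theorem elemIns_zero (x y : Λ) : elemIns x y (0 : Matrix C C ℝ) = 0 := by
  ext ⟨u, a⟩ ⟨v, b⟩
  simp only [elemIns_apply, Matrix.zero_apply]
  split_ifs <;> simp

omit [Fintype Λ] [Fintype C] [DecidableEq C] in
/-- `E_{x,y} ⊗ (t•m) = t•(E_{x,y} ⊗ m)`. [folklore] -/
theorem elemIns_smul (x y : Λ) (t : ℝ) (m : Matrix C C ℝ) : elemIns x y (t • m) = t • elemIns x y m := by
  ext ⟨u, a⟩ ⟨v, b⟩
  simp only [elemIns_apply, Matrix.smul_apply, smul_eq_mul]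
  split_ifs <;> simp

omit [Fintype Λ] [Fintype C] [DecidableEq C] in
/-- TRANSPOSE: `(E_{x,y} ⊗ m)ᵀ = E_{y,x} ⊗ mᵀ`. [folklore] -/
theorem transpose_elemIns (x y : Λ) (m : Matrix C C ℝ) : (elemIns x y m)ᵀ = elemIns y x mᵀ := by
  ext ⟨u, a⟩ ⟨v, b⟩
  simp only [Matrix.transpose_apply, elemIns_apply]
  by_cases h1 : v = x <;> by_cases h2 : u = y <;> simp [h1, h2]

omit [DecidableEq C] in
/-- PRODUCT: `(E_{x,y} ⊗ m)·(E_{y′,z} ⊗ m′) = [y = y′]·E_{x,z} ⊗ (m·m′)`. [folklore] -/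
theorem elemIns_mul_elemIns (x y y' z : Λ) (m m' : Matrix C C ℝ) :
    elemIns x y m * elemIns y' z m' = if y = y' then elemIns x z (m * m') else 0 := by
  ext ⟨u, a⟩ ⟨v, b⟩
  rw [mul_elemIns_apply]
  have hb : BubbleTable.block (elemIns x y m) u y' = if u = x ∧ y' = y then m else 0 := by
    ext c d
    simp only [BubbleTable.block_apply, elemIns_apply]
    split_ifs <;> rfl
  rw [hb]
  by_cases hy : y = y'
  · subst hy
    by_cases hv : v = z <;> by_cases hu : u = x <;> simp [hv, hu, Matrix.mul_apply]
  · have hy' : ¬ (y' = y) := fun h => hy h.symm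
    by_cases hv : v = z <;> simp [hv, hy, hy']

end ElemIns

/-! ## §1 The twisted covariant forward difference and its bond Laplacian: the background vertices DERIVED -/

section Operator

variable {Λ : Type*} [Fintype Λ] [DecidableEq Λ] [AddCommGroup Λ] {C : Type*} [Fintype C] [DecidableEq C]

/-- The colour-diagonal FORWARD DIFFERENCE along the lattice vector `e`: `(D_e λ)(y) = λ(y + e) − λ(y)`, as the matrix
`Σ_y (E_{y,y+e} ⊗ 1 − E_{y,y} ⊗ 1)` over `Λ × C`. [folklore] -/
def fwdDiff (e : Λ) : Matrix (Λ × C) (Λ × C) ℝ := ∑ y : Λ, (elemIns y (y + e) 1 - elemIns y y 1)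

/-- The TWIST DATUM at the bond `(x, x + e)` with colour matrix `A`: `E_{x,x+e} ⊗ A` (the first jet of the bond transporter
acting on the far endpoint). [folklore] -/
def twist (x e : Λ) (A : Matrix C C ℝ) : Matrix (Λ × C) (Λ × C) ℝ := elemIns x (x + e) A

/-- The TWISTED forward difference, to first order in the twist: `D(t) = D_e + t·(E_{x,x+e} ⊗ A)`. [folklore] -/
def twistedDiff (x e : Λ) (A : Matrix C C ℝ) (t : ℝ) : Matrix (Λ × C) (Λ × C) ℝ := fwdDiff e + t • twist x e A

/-- The BOND-LAPLACIAN FAMILY `K(t) = D(t)ᵀ·D(t) + R`, `R` = the (t-independent) contribution of every other bond and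
direction. [folklore] -/
def lapFamily (x e : Λ) (A : Matrix C C ℝ) (R : Matrix (Λ × C) (Λ × C) ℝ) (t : ℝ) : Matrix (Λ × C) (Λ × C) ℝ :=
  (twistedDiff x e A t)ᵀ * twistedDiff x e A t + R

/-- The FIRST-ORDER VERTEX `D_eᵀ·W + Wᵀ·D_e`, `W = E_{x,x+e} ⊗ A`. [folklore] -/
def vertex₁ (x e : Λ) (A : Matrix C C ℝ) : Matrix (Λ × C) (Λ × C) ℝ :=
  (fwdDiff e)ᵀ * twist x e A + (twist x e A)ᵀ * fwdDiff e

/-- The SECOND-ORDER (contact) VERTEX `Wᵀ·W`. [folklore] -/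
def vertex₂ (x e : Λ) (A : Matrix C C ℝ) : Matrix (Λ × C) (Λ × C) ℝ := (twist x e A)ᵀ * twist x e A

/-- **THE EXPANSION IS EXACT AND QUADRATIC**: `K(t) = K(0) + t·vertex₁ + t²·vertex₂` — the vertices ARE the Taylor
coefficients of the operator family (derivation, not transcription). [folklore] -/
theorem lapFamily_expand (x e : Λ) (A : Matrix C C ℝ) (R : Matrix (Λ × C) (Λ × C) ℝ) (t : ℝ) :
    lapFamily x e A R t = lapFamily x e A R 0 + t • vertex₁ x e A + t ^ 2 • vertex₂ x e A := by
  simp only [lapFamily, twistedDiff, vertex₁, vertex₂, zero_smul, add_zero, Matrix.transpose_add, Matrix.transpose_smul,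
    Matrix.add_mul, Matrix.mul_add, Matrix.smul_mul, Matrix.mul_smul, smul_add, smul_smul, pow_two]
  abel

/-- `D_eᵀ·(E_{x,x+e} ⊗ A) = E_{x+e,x+e} ⊗ A − E_{x,x+e} ⊗ A`. [folklore] -/
theorem fwdDiff_transpose_mul_twist (x e : Λ) (A : Matrix C C ℝ) :
    (fwdDiff (C := C) e)ᵀ * twist x e A = elemIns (x + e) (x + e) A - elemIns x (x + e) A := by
  simp only [fwdDiff, twist, Matrix.transpose_sum, Matrix.transpose_sub, transpose_elemIns, Matrix.transpose_one,
    Finset.sum_mul, Matrix.sub_mul, elemIns_mul_elemIns, Matrix.one_mul, Finset.sum_sub_distrib, Finset.sum_ite_eq',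
    Finset.mem_univ, if_true]

/-- `(E_{x,x+e} ⊗ A)ᵀ·D_e = E_{x+e,x+e} ⊗ Aᵀ − E_{x+e,x} ⊗ Aᵀ`. [folklore] -/
theorem twist_transpose_mul_fwdDiff (x e : Λ) (A : Matrix C C ℝ) :
    (twist x e A)ᵀ * fwdDiff (C := C) e = elemIns (x + e) (x + e) Aᵀ - elemIns (x + e) x Aᵀ := by
  simp only [fwdDiff, twist, transpose_elemIns, Finset.mul_sum, Matrix.mul_sub, elemIns_mul_elemIns, Matrix.mul_one,
    Finset.sum_sub_distrib]
  have h1 : ∑ y : Λ, (if x = y then elemIns (x + e) (y + e) Aᵀ else (0 : Matrix (Λ × C) (Λ × C) ℝ)) =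
      elemIns (x + e) (x + e) Aᵀ := by
    rw [Finset.sum_ite_eq, if_pos (Finset.mem_univ x)]
  have h2 : ∑ y : Λ, (if x = y then elemIns (x + e) y Aᵀ else (0 : Matrix (Λ × C) (Λ × C) ℝ)) = elemIns (x + e) x Aᵀ := by
    rw [Finset.sum_ite_eq, if_pos (Finset.mem_univ x)]
  rw [h1, h2]

/-- **THE FIRST-ORDER VERTEX, GENERAL COLOUR MATRIX**:
`vertex₁ = E_{x+e,x+e}⊗A − E_{x,x+e}⊗A + E_{x+e,x+e}⊗Aᵀ − E_{x+e,x}⊗Aᵀ` — a four-entry stencil at the bond. [folklore] -/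
theorem vertex₁_eq (x e : Λ) (A : Matrix C C ℝ) :
    vertex₁ x e A = elemIns (x + e) (x + e) A - elemIns x (x + e) A + (elemIns (x + e) (x + e) Aᵀ - elemIns (x + e) x Aᵀ) := by
  rw [vertex₁, fwdDiff_transpose_mul_twist, twist_transpose_mul_fwdDiff]

omit [DecidableEq C] in
/-- **THE CONTACT VERTEX**: `vertex₂ = E_{x+e,x+e} ⊗ (AᵀA)` — supported on the one site `x + e`. [folklore] -/
theorem vertex₂_eq (x e : Λ) (A : Matrix C C ℝ) : vertex₂ x e A = elemIns (x + e) (x + e) (Aᵀ * A) := by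
  rw [vertex₂, twist, transpose_elemIns, elemIns_mul_elemIns, if_pos rfl]

/-- The ANTISYMMETRIC LATTICE CURRENT at the bond `(x, x+e)` with colour matrix `A`: `E_{x+e,x} ⊗ A − E_{x,x+e} ⊗ A`.
[folklore] -/
def current (x e : Λ) (A : Matrix C C ℝ) : Matrix (Λ × C) (Λ × C) ℝ := elemIns (x + e) x A - elemIns x (x + e) A

/-- **SKEW COLOUR MATRIX ⟹ THE VERTEX IS THE CURRENT**: for `Aᵀ = −A` (the adjoint action of a Lie-algebra element is skew
for the invariant form), `vertex₁ = current` — the two diagonal entries cancel. [folklore] -/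
theorem vertex₁_eq_current (x e : Λ) {A : Matrix C C ℝ} (hA : Aᵀ = -A) : vertex₁ x e A = current x e A := by
  rw [vertex₁_eq, hA, elemIns_neg, elemIns_neg, current]
  abel

/-- Stencil data of the current: offsets of the row site. [folklore] -/
def curα (e : Λ) : Bool → Λ := fun b => if b then e else 0
/-- Stencil data of the current: offsets of the column site. [folklore] -/
def curβ (e : Λ) : Bool → Λ := fun b => if b then 0 else e
/-- Stencil data of the current: colour matrices `+A, −A` (coefficients summing to zero — the difference mechanism).
[folklore] -/
def curM (A : Matrix C C ℝ) : Bool → Matrix C C ℝ := fun b => if b then A else -A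

omit [Fintype Λ] [Fintype C] [DecidableEq C] in
/-- **THE CURRENT IS A `BubbleTable` STENCIL** with index set `Bool`. [folklore] -/
theorem current_eq_stencil (x e : Λ) (A : Matrix C C ℝ) :
    current x e A = stencilIns x (Finset.univ : Finset Bool) (curα e) (curβ e) (curM A) := by
  rw [stencilIns, Fintype.sum_bool]
  simp only [curα, curβ, curM, if_true, Bool.false_eq_true, if_false, add_zero, elemIns_neg, current, sub_eq_add_neg]

omit [Fintype Λ] [DecidableEq Λ] [AddCommGroup Λ] [Fintype C] [DecidableEq C] in
/-- The colour coefficients of the current sum to zero. [folklore] -/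
theorem curM_sum (A : Matrix C C ℝ) : ∑ b, curM A b = 0 := by
  rw [Fintype.sum_bool]; simp [curM]

/-! ### Two twists: distinct bonds of one direction have no cross term -/

/-- The family with TWO twisted bonds `(x, x+e)` and `(x′, x′+e)` of the same direction. [folklore] -/
def lapFamily₂ (x x' e : Λ) (A A' : Matrix C C ℝ) (R : Matrix (Λ × C) (Λ × C) ℝ) (s t : ℝ) : Matrix (Λ × C) (Λ × C) ℝ :=
  (fwdDiff e + s • twist x e A + t • twist x' e A')ᵀ * (fwdDiff e + s • twist x e A + t • twist x' e A') + R

omit [DecidableEq C] in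
/-- **NO CROSS TERM BETWEEN DISTINCT BONDS**: `(E_{x,x+e}⊗A)ᵀ·(E_{x′,x′+e}⊗A′) = 0` for `x ≠ x′`. [folklore] -/
theorem cross_eq_zero {x x' : Λ} (hx : x ≠ x') (e : Λ) (A A' : Matrix C C ℝ) : (twist x e A)ᵀ * twist x' e A' = 0 := by
  rw [twist, twist, transpose_elemIns, elemIns_mul_elemIns, if_neg hx]

/-- **THE TWO-BOND EXPANSION** (`x ≠ x′`): `K(s,t) = K(0,0) + s·vertex₁(x) + t·vertex₁(x′) + s²·vertex₂(x) + t²·vertex₂(x′)`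
— NO `st` term: the mixed second background derivative between distinct bonds is pure bubble (an2's `polarization` with
`V₂ = 0`; for bonds of DIFFERENT directions the two twists sit in different summands of `Σ_μ D_μᵀD_μ` and the same holds
trivially). [folklore] -/
theorem lapFamily₂_expand {x x' : Λ} (hx : x ≠ x') (e : Λ) (A A' : Matrix C C ℝ) (R : Matrix (Λ × C) (Λ × C) ℝ) (s t : ℝ) :
    lapFamily₂ x x' e A A' R s t = lapFamily₂ x x' e A A' R 0 0 + s • vertex₁ x e A + t • vertex₁ x' e A' +
      s ^ 2 • vertex₂ x e A + t ^ 2 • vertex₂ x' e A' := by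
  have h1 := cross_eq_zero hx e A A'
  have h2 := cross_eq_zero (Ne.symm hx) e A' A
  simp only [lapFamily₂, vertex₁, vertex₂, zero_smul, add_zero, Matrix.transpose_add, Matrix.transpose_smul,
    Matrix.add_mul, Matrix.mul_add, Matrix.smul_mul, Matrix.mul_smul, smul_add, smul_smul, pow_two, h1, h2, smul_zero]
  abel

end Operator

/-! ## §2 The bubble of two currents through a translation-invariant colour-diagonal propagator: an2's table, INSTANTIATED -/

section Bubble

variable {Λ : Type*} [Fintype Λ] [DecidableEq Λ] [AddCommGroup Λ] {C : Type*} [Fintype C] [DecidableEq C]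

/-- **THE GHOST BUBBLE IS FOUR PRODUCTS OF TWO LEGS** (an2's `BubbleTable.bubble_stencil_eq_table` for the current stencil):
`trace (G·J_{z,e,A}·(G·J_{z+w,e′,A′})) = trace(A·A′)·[g(e−w)g(w+e′) − g(e−e′−w)g(w) − g(−w)g(w+e′−e) + g(−e′−w)g(w−e)]`,
`G = convKernel g`. [folklore] -/
theorem bubble_current (g : Λ → ℝ) (z w e e' : Λ) (A A' : Matrix C C ℝ) :
    Matrix.trace (convKernel g * current z e A * (convKernel g * current (z + w) e' A')) =
      Matrix.trace (A * A') *
        (g (e - w) * g (w + e') - g (e - e' - w) * g w - g (-w) * g (w + e' - e) + g (-e' - w) * g (w - e)) := by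
  rw [current_eq_stencil, current_eq_stencil, bubble_stencil_eq_table, Finset.sum_product, Fintype.sum_bool,
    Fintype.sum_bool, Fintype.sum_bool]
  simp only [curα, curβ, curM, if_true, Bool.false_eq_true, if_false, Matrix.mul_neg, Matrix.neg_mul, neg_neg,
    Matrix.trace_neg, sub_zero, zero_sub, add_zero]
  ring

/-- **EVEN PROPAGATOR**: for `g(−v) = g(v)` the four products collapse to
`2·trace(A·A′)·(g(w−e)g(w+e′) − g(w)g(w+e′−e))`. [folklore] -/
theorem bubble_current_even {g : Λ → ℝ} (hg : ∀ v, g (-v) = g v) (z w e e' : Λ) (A A' : Matrix C C ℝ) :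
    Matrix.trace (convKernel g * current z e A * (convKernel g * current (z + w) e' A')) =
      2 * Matrix.trace (A * A') * (g (w - e) * g (w + e') - g w * g (w + e' - e)) := by
  rw [bubble_current]
  have h1 : g (e - w) = g (w - e) := by rw [← hg (w - e), neg_sub]
  have h2 : g (e - e' - w) = g (w + e' - e) := by rw [← hg (w + e' - e)]; congr 1; abel
  have h3 : g (-e' - w) = g (w + e') := by rw [← hg (w + e')]; congr 1; abel
  rw [h1, h2, h3, hg]
  ring

end Bubble

/-! ## §3 The unit-cell identity: the four products regrouped as a degree-6 table (pure algebra, any additive group) -/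

section Cell

variable {Λ : Type*} [AddCommGroup Λ]

/-- The forward difference of a function along `e`: `F_e g (v) = g(v+e) − g(v)`. [folklore] -/
def fwdDiffFun (g : Λ → ℝ) (e : Λ) (v : Λ) : ℝ := g (v + e) - g v

/-- The forward MIXED second difference over the cell spanned by `e, e′` at the corner `v`:
`D g e e′ (v) = g(v+e′+e) − g(v+e′) − g(v+e) + g(v)` (argument order as in `TwoPowerLegs.TwoPower.mixedLeg`). [folklore] -/
def mixedDiffFun (g : Λ → ℝ) (e e' : Λ) (v : Λ) : ℝ := g (v + e' + e) - g (v + e') - g (v + e) + g v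

/-- The CELL FORM of the ghost table at the corner `v`: `g(v)·D(v) − F_e(v)·F_{e′}(v)` — degrees `2 + 4` and `3 + 3`.
[folklore] -/
def cellForm (g : Λ → ℝ) (e e' : Λ) (v : Λ) : ℝ :=
  g v * mixedDiffFun g e e' v - fwdDiffFun g e v * fwdDiffFun g e' v

omit [AddCommGroup Λ] in
/-- auxiliary commutation of the cell's far corner. [folklore] -/
theorem cell_corner [AddCommGroup Λ] (v e e' : Λ) : v + e + e' = v + e' + e := add_right_comm v e e'

/-- **THE UNIT-CELL IDENTITY**: `g(v)g(v+e′+e) − g(v+e)g(v+e′) = g(v)·D(v) − F_e(v)·F_{e′}(v)` — the difference mechanism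
with no Ward input. [folklore] -/
theorem cell_identity (g : Λ → ℝ) (e e' v : Λ) :
    g v * g (v + e' + e) - g (v + e) * g (v + e') = cellForm g e e' v := by
  simp only [cellForm, mixedDiffFun, fwdDiffFun]
  ring

/-- **THE EVEN-FORM BRACKET AT OFFSET `w = v + e` IS THE CELL FORM AT THE CORNER `v`**:
`g(w−e)g(w+e′) − g(w)g(w+e′−e) = cellForm g e e′ v`. [folklore] -/
theorem bracket_eq_cellForm (g : Λ → ℝ) (e e' v : Λ) :
    g (v + e - e) * g (v + e + e') - g (v + e) * g (v + e + e' - e) = cellForm g e e' v := by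
  rw [add_sub_cancel_right, cell_corner, show v + e' + e - e = v + e' from add_sub_cancel_right _ _, ← cell_identity]

/-- **POINT REFLECTION OF THE CELL** (the Hessian symmetry `(μ,z) ↔ (ν,z′)`): for even `g`,
`cellForm g e′ e (−v − e − e′) = cellForm g e e′ v`. [folklore] -/
theorem cell_reflect {g : Λ → ℝ} (hg : ∀ v, g (-v) = g v) (e e' v : Λ) :
    cellForm g e' e (-v - e - e') = cellForm g e e' v := by
  have h0 : g (-v - e - e') = g (v + e' + e) := by rw [← hg (v + e' + e)]; congr 1; abel
  have h1 : g (-v - e - e' + e) = g (v + e') := by rw [← hg (v + e')]; congr 1; abel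
  have h2 : g (-v - e - e' + e') = g (v + e) := by rw [← hg (v + e)]; congr 1; abel
  have h3 : g (-v - e - e' + e + e') = g v := by rw [← hg v]; congr 1; abel
  simp only [cellForm, mixedDiffFun, fwdDiffFun, h0, h1, h2, h3]
  ring

end Cell

section BubbleCell

variable {Λ : Type*} [Fintype Λ] [DecidableEq Λ] [AddCommGroup Λ] {C : Type*} [Fintype C] [DecidableEq C]

/-- **THE GHOST BUBBLE IN CELL FORM**: with the second current based at `z + (v + e)` — i.e. `v` = (base of the `e′`-bond)
− (head of the `e`-bond) — and `g` even,
`trace (G·J_{z,e,A}·(G·J_{z+(v+e),e′,A′})) = 2·trace(A·A′)·cellForm g e e′ v`. [folklore] -/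
theorem bubble_current_cell {g : Λ → ℝ} (hg : ∀ v, g (-v) = g v) (z v e e' : Λ) (A A' : Matrix C C ℝ) :
    Matrix.trace (convKernel g * current z e A * (convKernel g * current (z + (v + e)) e' A')) =
      2 * Matrix.trace (A * A') * cellForm g e e' v := by
  rw [bubble_current_even hg, bracket_eq_cellForm]

end BubbleCell

/-! ## §4 On `ℤ⁴` with the free legs: the ghost table as a `BubbleTransfer` leg table; degrees, continuum bubble, value -/

section Z4

/-- The free massless lattice propagator in the tree normalisation, `g = latticeGreen/2` (= `TwoPowerLegs.free.g L k` for
every `(L,k)`, = `BubbleTransfer.freeLeg.f`). [folklore] -/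
def gFree (v : Pt) : ℝ := latticeGreen v / 2

/-- `gFree` is `free.g`. [folklore] -/
@[simp] theorem free_g_eq (L k : ℕ) (v : Pt) : free.g L k v = gFree v := rfl

/-- The table's coefficients `(2τ, −2τ)`, `τ` = the colour trace `trace(A·A′)`. [folklore] -/
def ghostCoeff (τ : ℝ) : Bool → ℝ := fun b => if b then 2 * τ else -(2 * τ)

/-- The table's first legs: `g` (degree 2) and `F_μ g` (degree 3). [folklore] -/
def ghostP (μ : Fin 4) : Bool → Leg := fun b => if b then free.baseLeg else free.fwdLeg μ

/-- The table's second legs: the forward mixed difference `D g` (degree 4) and `F_ν g` (degree 3). [folklore] -/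
def ghostQ {μ ν : Fin 4} (hμν : μ ≠ ν) : Bool → Leg := fun b => if b then freeMixedLeg hμν else free.fwdLeg ν

/-- **`hdeg`**: every entry of the ghost table has total degree `6` (`2 + 4` and `3 + 3`). [folklore] -/
theorem hdeg_ghost {μ ν : Fin 4} (hμν : μ ≠ ν) :
    ∀ i ∈ (Finset.univ : Finset Bool), (ghostP μ i).a + (ghostQ hμν i).a = 6 := by
  intro i _
  cases i <;> simp [ghostP, ghostQ, TwoPower.baseLeg_a, TwoPower.fwdLeg_a, freeMixedLeg_a]

/-- unfolding of the mixed leg's lattice function. [folklore] -/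
theorem freeMixedLeg_f {μ ν : Fin 4} (hμν : μ ≠ ν) (L k : ℕ) (w : Pt) :
    (freeMixedLeg hμν).f L k w = gFree (w + unitVec ν + unitVec μ) - gFree (w + unitVec ν) - gFree (w + unitVec μ) + gFree w :=
  rfl

/-- **THE LATTICE TABLE IS THE CELL FORM**: `lattBubble = 2τ·cellForm gFree e_μ e_ν` at every `(L,k)` (the free legs do not
depend on `(L,k)`). [folklore] -/
theorem lattBubble_ghost {μ ν : Fin 4} (hμν : μ ≠ ν) (τ : ℝ) (L k : ℕ) (v : Pt) :
    lattBubble Finset.univ (ghostCoeff τ) (ghostP μ) (ghostQ hμν) L k v = 2 * τ * cellForm gFree (unitVec μ) (unitVec ν) v := by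
  rw [lattBubble, Fintype.sum_bool]
  simp only [ghostCoeff, ghostP, ghostQ, if_true, Bool.false_eq_true, if_false, TwoPower.baseLeg_f, TwoPower.fwdLeg_f,
    free_g_eq, freeMixedLeg_f, cellForm, mixedDiffFun, fwdDiffFun]
  ring

/-- **THE CONTINUUM BUBBLE OF THE GHOST TABLE IS `τ·c₄²·scalarBubble`** (`= 2τc₄²(|x|⁻²·∂_μ∂_ν|x|⁻² − ∂_μ|x|⁻²·∂_ν|x|⁻²)`,
via `BubbleTransfer.hessInvQuartic_eq_legs`). [folklore] -/
theorem contBubble_ghost {μ ν : Fin 4} (hμν : μ ≠ ν) (τ : ℝ) (x : E4) :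
    contBubble Finset.univ (ghostCoeff τ) (ghostP μ) (ghostQ hμν) x = τ * c4 ^ 2 * scalarBubble μ ν x := by
  rw [contBubble, Fintype.sum_bool]
  simp only [ghostCoeff, ghostP, ghostQ, if_true, Bool.false_eq_true, if_false, TwoPower.baseLeg_ℓ, TwoPower.fwdLeg_ℓ,
    freeMixedLeg_ℓ, scalarBubble, hessInvQuartic_eq_legs]
  ring

/-- **`hval` FOR THE GHOST SECTOR**: `x_μ·x_ν·contBubble = leadingIntegrand (τ·c₄²/3) μ ν x` (`μ ≠ ν`; `scalarBubble = T/3`,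
`x_μx_νT = transverseUnit`). [folklore] -/
theorem hval_ghost {μ ν : Fin 4} (hμν : μ ≠ ν) (τ : ℝ) (x : E4) :
    x μ * x ν * contBubble Finset.univ (ghostCoeff τ) (ghostP μ) (ghostQ hμν) x = leadingIntegrand (τ * c4 ^ 2 / 3) μ ν x := by
  rw [contBubble_ghost, scalarBubble_eq, ← smul_moment_eq_leadingIntegrand hμν]
  ring

/-- The same in the binder shape of `ComposedRoad` (`∀ x ≠ 0`). [folklore] -/
theorem hval_ghost_shape {μ ν : Fin 4} (hμν : μ ≠ ν) (τ : ℝ) :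
    ∀ x : E4, x ≠ 0 → x μ * x ν * contBubble Finset.univ (ghostCoeff τ) (ghostP μ) (ghostQ hμν) x =
      leadingIntegrand (τ * c4 ^ 2 / 3) μ ν x :=
  fun x _ => hval_ghost hμν τ x

/-! ### Sector additivity of `hval` -/

/-- `contBubble` over a disjoint union of tables is the sum. [folklore] -/
theorem contBubble_union {ι : Type*} [DecidableEq ι] {s₁ s₂ : Finset ι} (h : Disjoint s₁ s₂) (c : ι → ℝ) (P Q : ι → Leg)
    (x : E4) : contBubble (s₁ ∪ s₂) c P Q x = contBubble s₁ c P Q x + contBubble s₂ c P Q x := by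
  rw [contBubble, contBubble, contBubble, Finset.sum_union h]

/-- `lattBubble` over a disjoint union of tables is the sum. [folklore] -/
theorem lattBubble_union {ι : Type*} [DecidableEq ι] {s₁ s₂ : Finset ι} (h : Disjoint s₁ s₂) (c : ι → ℝ) (P Q : ι → Leg)
    (L k : ℕ) (w : Pt) : lattBubble (s₁ ∪ s₂) c P Q L k w = lattBubble s₁ c P Q L k w + lattBubble s₂ c P Q L k w := by
  rw [lattBubble, lattBubble, lattBubble, Finset.sum_union h]

/-- **`hval` CONSTANTS ADD OVER DISJOINT SECTORS**: tables with `hval` constants `κ₁`, `κ₂` on disjoint index sets give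
`hval` with `κ₁ + κ₂` on the union. [folklore] -/
theorem hval_of_sectors {ι : Type*} [DecidableEq ι] {s₁ s₂ : Finset ι} (h : Disjoint s₁ s₂) (c : ι → ℝ) (P Q : ι → Leg)
    {μ ν : Fin 4} {κ₁ κ₂ : ℝ}
    (h₁ : ∀ x : E4, x ≠ 0 → x μ * x ν * contBubble s₁ c P Q x = leadingIntegrand κ₁ μ ν x)
    (h₂ : ∀ x : E4, x ≠ 0 → x μ * x ν * contBubble s₂ c P Q x = leadingIntegrand κ₂ μ ν x) :
    ∀ x : E4, x ≠ 0 → x μ * x ν * contBubble (s₁ ∪ s₂) c P Q x = leadingIntegrand (κ₁ + κ₂) μ ν x := by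
  intro x hx
  rw [contBubble_union h, mul_add, h₁ x hx, h₂ x hx, leadingIntegrand_apply, leadingIntegrand_apply, leadingIntegrand_apply]
  ring

/-- idem for the degrees: `hdeg` on each sector gives `hdeg` on the union. [folklore] -/
theorem hdeg_of_sectors {ι : Type*} [DecidableEq ι] {s₁ s₂ : Finset ι} (P Q : ι → Leg)
    (h₁ : ∀ i ∈ s₁, (P i).a + (Q i).a = 6) (h₂ : ∀ i ∈ s₂, (P i).a + (Q i).a = 6) :
    ∀ i ∈ s₁ ∪ s₂, (P i).a + (Q i).a = 6 := by
  intro i hi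
  rcases Finset.mem_union.mp hi with h | h
  · exact h₁ i h
  · exact h₂ i h

end Z4

/-! ## §5 The dictionary instance `τ = 2N²` (LABELLED DICTIONARY, AN3.md §6.5 (D3)/(D4)): the ghost share `kappaBal N/11` -/

section Dictionary

/-- **THE GHOST CONSTANT**: `2N²·c₄²/3 = kappaBal N/11`. [folklore] -/
theorem kappa_ghost_eq (N : ℝ) : 2 * N ^ 2 * c4 ^ 2 / 3 = kappaBal N / 11 := by
  rw [c4, kappaBal]
  have hπ : Real.pi ≠ 0 := Real.pi_ne_zero
  field_simp
  ring

/-- The ghost summand of `BubbleTransfer.piBal` (`piBal = 2N·(N·c₄²·(gluonBubble + ghostBubble))`) is `(kappaBal N/11)·T`.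
[folklore] -/
theorem piBal_ghost_part (N : ℝ) (μ ν : Fin 4) (x : E4) :
    2 * N * (N * c4 ^ 2 * ghostBubble μ ν x) = kappaBal N / 11 * transverse μ ν x := by
  rw [ghostBubble_eq, ← kappa_ghost_eq]
  ring

/-- and the gluon summand is `(10·kappaBal N/11)·T`. [folklore] -/
theorem piBal_gluon_part (N : ℝ) (μ ν : Fin 4) (x : E4) :
    2 * N * (N * c4 ^ 2 * gluonBubble μ ν x) = 10 * kappaBal N / 11 * transverse μ ν x := by
  rw [gluonBubble, scalarBubble_eq, kappaBal, c4]
  have hπ : Real.pi ≠ 0 := Real.pi_ne_zero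
  field_simp
  ring

/-- `piBal` IS the sum of the two sector summands (consistency with `BubbleTransfer.piBal_eq`). [folklore] -/
theorem piBal_eq_sectors (N : ℝ) (μ ν : Fin 4) (x : E4) :
    piBal N μ ν x = 2 * N * (N * c4 ^ 2 * gluonBubble μ ν x) + 2 * N * (N * c4 ^ 2 * ghostBubble μ ν x) := by
  rw [piBal, piOmega, bfBubble]
  ring

/-- The two sector constants add up to the wall's constant. [folklore] -/
theorem kappaBal_sectors (N : ℝ) : kappaBal N / 11 + 10 * kappaBal N / 11 = kappaBal N := by ring

/-- **`hval` OF THE DERIVED GHOST TABLE AT THE DICTIONARY VALUE `τ = 2N²`**: constant `kappaBal N/11`. [folklore] -/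
theorem hval_ghost_bal {μ ν : Fin 4} (hμν : μ ≠ ν) (N : ℝ) :
    ∀ x : E4, x ≠ 0 → x μ * x ν * contBubble Finset.univ (ghostCoeff (2 * N ^ 2)) (ghostP μ) (ghostQ hμν) x =
      leadingIntegrand (kappaBal N / 11) μ ν x := by
  intro x _
  rw [hval_ghost hμν, kappa_ghost_eq]

/-- and its continuum bubble IS the ghost summand of `piBal` (`2N·N·c₄²·ghostBubble`). [folklore] -/
theorem contBubble_ghost_bal {μ ν : Fin 4} (hμν : μ ≠ ν) (N : ℝ) (x : E4) :
    contBubble Finset.univ (ghostCoeff (2 * N ^ 2)) (ghostP μ) (ghostQ hμν) x = 2 * N * (N * c4 ^ 2 * ghostBubble μ ν x) := by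
  rw [contBubble_ghost, ghostBubble]
  ring

end Dictionary

/-! ## §6 Jet-independence of the first vertex: an arbitrary second jet of the bond transporter changes only `t²` and beyond -/

section Jets

variable {Λ : Type*} [Fintype Λ] [DecidableEq Λ] [AddCommGroup Λ] {C : Type*} [Fintype C] [DecidableEq C]

/-- The twisted forward difference with an ARBITRARY SECOND JET `B` of the bond transporter (`1 + tA + t²B + …`; for
`exp(tA)`, `B = A²/2`): `D(t) = D_e + t·(E_{x,x+e}⊗A) + t²·(E_{x,x+e}⊗B)`. [folklore] -/
def twistedDiff₂ (x e : Λ) (A B : Matrix C C ℝ) (t : ℝ) : Matrix (Λ × C) (Λ × C) ℝ :=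
  fwdDiff e + t • twist x e A + t ^ 2 • twist x e B

/-- The bond-Laplacian family of the two-jet transporter. [folklore] -/
def lapFamilyJ (x e : Λ) (A B : Matrix C C ℝ) (R : Matrix (Λ × C) (Λ × C) ℝ) (t : ℝ) : Matrix (Λ × C) (Λ × C) ℝ :=
  (twistedDiff₂ x e A B t)ᵀ * twistedDiff₂ x e A B t + R

/-- The `t³` cross term of the two jets. [folklore] -/
def jetCross (x e : Λ) (A B : Matrix C C ℝ) : Matrix (Λ × C) (Λ × C) ℝ :=
  (twist x e A)ᵀ * twist x e B + (twist x e B)ᵀ * twist x e A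

/-- **THE FIRST VERTEX IS JET-INDEPENDENT**: with any second jet `B`,
`K(t) = K(0) + t·vertex₁(A) + t²·(vertex₂(A) + vertex₁(B)) + t³·jetCross + t⁴·vertex₂(B)` — the LINEAR Taylor coefficient is `vertex₁ x e A`
whatever `B` is; higher jets enter at order `t²` and beyond (so for the exact transporter `exp(tA)` the bubble of §2, which is bilinear in the
first-order vertices, is unchanged; only contact terms change). [folklore] -/
theorem lapFamilyJ_expand (x e : Λ) (A B : Matrix C C ℝ) (R : Matrix (Λ × C) (Λ × C) ℝ) (t : ℝ) :
    lapFamilyJ x e A B R t = lapFamilyJ x e A B R 0 + t • vertex₁ x e A + t ^ 2 • (vertex₂ x e A + vertex₁ x e B) +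
      t ^ 3 • jetCross x e A B + t ^ 4 • vertex₂ x e B := by
  simp only [lapFamilyJ, twistedDiff₂, vertex₁, vertex₂, jetCross, Matrix.transpose_add, Matrix.transpose_smul, Matrix.add_mul,
    Matrix.mul_add, Matrix.smul_mul, Matrix.mul_smul, smul_add, smul_smul, zero_smul, add_zero, ne_eq, OfNat.ofNat_ne_zero,
    not_false_eq_true, zero_pow]
  module

/-- In particular the linear coefficient: `K(t) − K(0) − t·vertex₁(A)` is `O(t²)` with an explicit polynomial remainder. [folklore] -/
theorem lapFamilyJ_linear (x e : Λ) (A B : Matrix C C ℝ) (R : Matrix (Λ × C) (Λ × C) ℝ) (t : ℝ) :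
    lapFamilyJ x e A B R t - lapFamilyJ x e A B R 0 - t • vertex₁ x e A =
      t ^ 2 • (vertex₂ x e A + vertex₁ x e B + t • jetCross x e A B + t ^ 2 • vertex₂ x e B) := by
  rw [lapFamilyJ_expand]
  module

end Jets

/-! ## §7 Vector copies: the covariant vector Laplacian `⊕_ν D_U*D_U` has the same current with `A ⊗ 1_D` (trace factor `card D`) -/

section Copies

variable {Λ : Type*} [Fintype Λ] [DecidableEq Λ] [AddCommGroup Λ] {C : Type*} [Fintype C] [DecidableEq C]
variable (D : Type*) [Fintype D] [DecidableEq D]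

/-- `card D` identical copies of the colour matrix: `A ⊗ 1_D` as a block-diagonal matrix on `C × D` (the internal space of a
`D`-component field in the adjoint representation; `D = Fin d` for the vector potential). [folklore] -/
def copies (A : Matrix C C ℝ) : Matrix (C × D) (C × D) ℝ := Matrix.blockDiagonal fun _ : D => A

omit [Fintype C] [DecidableEq C] [Fintype D] in
/-- transpose of the copies. [folklore] -/
theorem copies_transpose (A : Matrix C C ℝ) : (copies D A)ᵀ = copies D Aᵀ := by
  rw [copies, copies, Matrix.blockDiagonal_transpose]

omit [Fintype C] [DecidableEq C] [Fintype D] in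
/-- SKEWNESS IS INHERITED: `Aᵀ = −A ⟹ (A ⊗ 1)ᵀ = −(A ⊗ 1)` (so `vertex₁_eq_current` applies to the vector sector). [folklore] -/
theorem copies_skew {A : Matrix C C ℝ} (hA : Aᵀ = -A) : (copies D A)ᵀ = -copies D A := by
  rw [copies_transpose, hA, copies, copies, ← Matrix.blockDiagonal_neg]
  rfl

omit [DecidableEq C] in
/-- **THE COLOUR TRACE OF THE COPIES**: `trace ((A ⊗ 1_D)(A′ ⊗ 1_D)) = card D · trace (A A′)`. [folklore] -/
theorem trace_copies_mul (A A' : Matrix C C ℝ) :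
    Matrix.trace (copies D A * copies D A') = Fintype.card D * Matrix.trace (A * A') := by
  rw [copies, copies, ← Matrix.blockDiagonal_mul, Matrix.trace_blockDiagonal, Finset.sum_const, Finset.card_univ, nsmul_eq_mul]

/-- **THE VECTOR-LAPLACIAN SECTOR'S BUBBLE IS `card D` COPIES OF THE GHOST BUBBLE** (same four products of two legs, trace factor
`card D · trace(AA′)`). [folklore] -/
theorem bubble_current_copies (g : Λ → ℝ) (z w e e' : Λ) (A A' : Matrix C C ℝ) :
    Matrix.trace (convKernel g * current z e (copies D A) * (convKernel g * current (z + w) e' (copies D A'))) =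
      Fintype.card D * Matrix.trace (A * A') *
        (g (e - w) * g (w + e') - g (e - e' - w) * g w - g (-w) * g (w + e' - e) + g (-e' - w) * g (w - e)) := by
  rw [bubble_current, trace_copies_mul]

/-- and in cell form. [folklore] -/
theorem bubble_current_copies_cell {g : Λ → ℝ} (hg : ∀ v, g (-v) = g v) (z v e e' : Λ) (A A' : Matrix C C ℝ) :
    Matrix.trace (convKernel g * current z e (copies D A) * (convKernel g * current (z + (v + e)) e' (copies D A'))) =
      2 * (Fintype.card D * Matrix.trace (A * A')) * cellForm g e e' v := by
  rw [bubble_current_cell hg, trace_copies_mul]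

end Copies

/-! ## §8 The `su(2)` instance of the colour dictionary (B12's group): Pauli relations, the real matrices `i·ad(σ^a)`, skewness,
`trace(A_aA_b) = −8δ_ab = −2N²δ_ab|_{N=2}`, and the ghost `hval` constant `kappaBal 2/11` COMPUTED rather than labelled -/

section SU2

/-- The Levi-Civita symbol on `Fin 3`. [folklore] -/
def lc (a b c : Fin 3) : ℝ :=
  if (a = 0 ∧ b = 1 ∧ c = 2) ∨ (a = 1 ∧ b = 2 ∧ c = 0) ∨ (a = 2 ∧ b = 0 ∧ c = 1) then 1
  else if (a = 0 ∧ b = 2 ∧ c = 1) ∨ (a = 2 ∧ b = 1 ∧ c = 0) ∨ (a = 1 ∧ b = 0 ∧ c = 2) then -1 else 0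

/-- The Pauli matrices `σ¹, σ², σ³`. [folklore] -/
def pauli : Fin 3 → Matrix (Fin 2) (Fin 2) ℂ
  | 0 => !![0, 1; 1, 0]
  | 1 => !![0, -Complex.I; Complex.I, 0]
  | 2 => !![1, 0; 0, -1]

/-- **B12's NORMALISATION AT `N = 2`**: the Pauli matrices are ORTHONORMAL for the normalised trace `(1/N)Tr = ½Tr`
(`½Tr(σ^aσ^b) = δ^{ab}`) — so B12's basis `t^a` (orthonormal for `(1/N)Tr`, AN3 §6.5 (D4)) is `σ^a` itself at `N = 2`. [folklore] -/
theorem pauli_orthonormal (a b : Fin 3) : Matrix.trace (pauli a * pauli b) / 2 = if a = b then 1 else 0 := by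
  fin_cases a <;> fin_cases b <;> simp [pauli, Matrix.trace, Fin.sum_univ_two]

/-- **THE `su(2)` RELATIONS**: `[σ^a, σ^b] = 2i·Σ_c ε_{abc} σ^c`. [folklore] -/
theorem pauli_comm (a b : Fin 3) :
    pauli a * pauli b - pauli b * pauli a = ∑ c : Fin 3, ((2 : ℂ) * Complex.I * lc a b c) • pauli c := by
  fin_cases a <;> fin_cases b <;>
    (ext i j; fin_cases i <;> fin_cases j <;>
      simp [pauli, lc, Fin.sum_univ_three, Matrix.sum_apply] <;> ring_nf <;> simp)

/-- The REAL `3 × 3` matrix of `i·ad(σ^a)` in the basis `(σ¹, σ², σ³)`: `(i·ad σ^a) σ^c = Σ_d (A_a)_{dc} σ^d` with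
`(A_a)_{dc} = i·2i·ε_{acd} = −2ε_{acd}` — the linearisation of the adjoint transporter `exp(iηH)`, `H = H^aσ^a` (B12 p. 258's letter), acting on a Lie-algebra-valued
(ghost) field. [folklore] -/
def adPauli (a : Fin 3) : Matrix (Fin 3) (Fin 3) ℝ := Matrix.of fun d c => -2 * lc a c d

/-- **`adPauli` IS `i·ad(σ^a)`**: `i·[σ^a, σ^c] = Σ_d (A_a)_{dc}·σ^d`. [folklore] -/
theorem adPauli_spec (a c : Fin 3) :
    Complex.I • (pauli a * pauli c - pauli c * pauli a) = ∑ d : Fin 3, ((adPauli a d c : ℝ) : ℂ) • pauli d := by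
  rw [pauli_comm, Finset.smul_sum]
  refine Finset.sum_congr rfl fun d _ => ?_
  rw [smul_smul, adPauli, Matrix.of_apply]
  congr 1
  push_cast
  linear_combination ((2 : ℂ) * (lc a c d : ℂ)) * Complex.I_mul_I

/-- **SKEWNESS** (`ε` is antisymmetric): `A_aᵀ = −A_a` — the hypothesis of `vertex₁_eq_current`. [folklore] -/
theorem adPauli_transpose (a : Fin 3) : (adPauli a)ᵀ = -adPauli a := by
  ext d c
  fin_cases a <;> fin_cases d <;> fin_cases c <;> simp [adPauli, lc]

/-- **THE COLOUR TRACE**: `trace(A_aA_b) = −8δ_{ab}` (`= −2N²δ_{ab}` at `N = 2`: adjoint Casimir `C_A = N = 2` times B12's `2N = 4`,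
with the sign of `i² `). [folklore] -/
theorem trace_adPauli_mul (a b : Fin 3) : Matrix.trace (adPauli a * adPauli b) = if a = b then -8 else 0 := by
  fin_cases a <;> fin_cases b <;>
    simp [adPauli, lc, Matrix.trace, Matrix.mul_apply, Fin.sum_univ_three] <;> norm_num

/-- the diagonal value as `−2N²` at `N = 2`. [folklore] -/
theorem trace_adPauli_sq (a : Fin 3) : Matrix.trace (adPauli a * adPauli a) = -(2 * (2 : ℝ) ^ 2) := by
  rw [trace_adPauli_mul, if_pos rfl]; norm_num

variable {Λ : Type*} [Fintype Λ] [DecidableEq Λ] [AddCommGroup Λ]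

/-- For the `su(2)` ghost: the bond vertex IS the antisymmetric current (no hypothesis left). [folklore] -/
theorem vertex₁_adPauli (x e : Λ) (a : Fin 3) : vertex₁ x e (adPauli a) = current x e (adPauli a) :=
  vertex₁_eq_current x e (adPauli_transpose a)

/-- **THE `su(2)` GHOST POLARIZATION IN CELL FORM**: with an2's convention `Π = contact − bubble` (`BubbleTable.polarization`; the
mixed `μ ≠ ν` derivative has no contact term, §1), the off-contact ghost polarization between the bond `(z, e)` twisted by `σ^a` and
the bond `(z + v + e, e′)` twisted by `σ^a` through an even colour-diagonal propagator is `−trace(G J G J′) = 16·cellForm g e e′ v`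
(`−2·(−8) = 16 = 2·(2N²)|_{N=2}`). [folklore] -/
theorem polarization_ghost_su2 {g : Λ → ℝ} (hg : ∀ v, g (-v) = g v) (z v e e' : Λ) (a : Fin 3) :
    -Matrix.trace (convKernel g * current z e (adPauli a) * (convKernel g * current (z + (v + e)) e' (adPauli a))) =
      16 * cellForm g e e' v := by
  rw [bubble_current_cell hg, trace_adPauli_sq]
  ring

/-- and colour-off-diagonal pairs `a ≠ b` give zero (`Π^{ab} = δ^{ab}Π`). [folklore] -/
theorem polarization_ghost_su2_offdiag {g : Λ → ℝ} (hg : ∀ v, g (-v) = g v) (z v e e' : Λ) {a b : Fin 3} (hab : a ≠ b) :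
    Matrix.trace (convKernel g * current z e (adPauli a) * (convKernel g * current (z + (v + e)) e' (adPauli b))) = 0 := by
  rw [bubble_current_cell hg, trace_adPauli_mul, if_neg hab]
  ring

/-- **ON `ℤ⁴`: the `su(2)` ghost table is `ghostCoeff 8`** — `16·cellForm gFree e_μ e_ν`, the same algebraic form as the torus
polarization above (the torus ↔ `ℤ⁴` matching of `g` itself is NOT asserted, §14.3 (iv) of AN3.md). [folklore] -/
theorem lattBubble_ghost_su2 {μ ν : Fin 4} (hμν : μ ≠ ν) (L k : ℕ) (v : Pt) :
    lattBubble Finset.univ (ghostCoeff (-(Matrix.trace (adPauli 0 * adPauli 0)))) (ghostP μ) (ghostQ hμν) L k v =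
      16 * cellForm gFree (unitVec μ) (unitVec ν) v := by
  rw [trace_adPauli_sq, lattBubble_ghost]
  norm_num

/-- **`hval` OF THE `su(2)` GHOST TABLE, CONSTANT COMPUTED FROM THE GROUP**: `τ = −trace(A_aA_a) = 8 = 2·2²` ⟹
`x_μx_ν·contBubble = leadingIntegrand (kappaBal 2 / 11) μ ν x` — the colour factor of AN3 §6.5 (D4) at `N = 2` is now the computed
`trace_adPauli_sq`, not a label; what REMAINS labelled is the orientation reading (D3) (`Π^{Bal} = −Hess_B Ω`, i.e. the overall sign
`−bubble`) and B12's identification of its `B^a` with the `½Tr`-orthonormal basis (`pauli_orthonormal`). [folklore] -/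
theorem hval_ghost_su2 {μ ν : Fin 4} (hμν : μ ≠ ν) (a : Fin 3) :
    ∀ x : E4, x ≠ 0 → x μ * x ν * contBubble Finset.univ (ghostCoeff (-(Matrix.trace (adPauli a * adPauli a)))) (ghostP μ) (ghostQ hμν) x =
      leadingIntegrand (kappaBal 2 / 11) μ ν x := by
  rw [trace_adPauli_sq, neg_neg]
  exact hval_ghost_bal hμν 2

end SU2

/-! ## §9 (v1.3) General `N`: the colour factor COMPUTED from Bałaban's generator conventions via `Beta.ColourTrace` (lit1-g8)

`Beta.ColourTrace` (p182253) formalises the printed conventions (C1) B9 p. 391–392 (𝔤 = Hermitian matrices, normalised trace,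
transport `λ ↦ λ + η·i[A, λ] + …`) and (C2) B12 p. 289 (components in a tr-orthonormal generator family `τ`), and PROVES
`(adMat τ X)ᵀ = −adMat τ X` and `trace(adMat τ (τ_a) · adMat τ (τ_b)) = −2N²·δ_ab` for every complete tr-orthonormal Hermitian
family.  Below: the §8 statements with `adPauli a` replaced by `adMat τ (τ a)` for ANY such family and any `N ≠ 0` — the bond vertex
is the current with no hypothesis left, the torus polarization is `2·(2N²)·cellForm` on the colour diagonal and `0` off it, and on
`ℤ⁴` the ghost table with `τ := −trace(A_aA_a)` has `hval` constant `kappaBal N/11`: the magnitude `2N²` of AN3 §6.5 (D4) is now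
COMPUTED for all `N` from (C1)–(C2); what remains LABELLED is the orientation reading (D3) (`Π = −Hess Ω`, the overall `−bubble`)
and the identification of B12's `B^a` with the tr-orthonormal components (ColourTrace header, «WHAT IS NOT CLAIMED»). -/

section GeneralN

open Literature.MathematicalPhysics.QuantumFieldTheory.Balaban1983to89.Beta.ColourTrace
  (adMat adMat_transpose trace_adMat_gen Complete TrOrthonormal)

variable {N : ℕ} {C : Type*} [Fintype C] [DecidableEq C] {τ : C → Matrix (Fin N) (Fin N) ℂ}

/-- the diagonal value `trace(A_aA_a) = −2N²`. [folklore] -/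
theorem trace_adMat_gen_sq (hτ : Complete τ) (ho : TrOrthonormal τ) (hH : ∀ c, (τ c).IsHermitian) (hN : N ≠ 0) (a : C) :
    Matrix.trace (adMat τ (τ a) * adMat τ (τ a)) = -(2 * (N : ℝ) ^ 2) := by
  rw [trace_adMat_gen hτ ho hH hN, if_pos rfl]

variable {Λ : Type*} [Fintype Λ] [DecidableEq Λ] [AddCommGroup Λ]

/-- **THE BOND VERTEX IS THE ANTISYMMETRIC CURRENT for every adjoint-action matrix** (skewness from `ColourTrace.adMat_transpose`,
no hypothesis on `X` or `τ`). [folklore] -/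
theorem vertex₁_adMat (x e : Λ) (τ : C → Matrix (Fin N) (Fin N) ℂ) (X : Matrix (Fin N) (Fin N) ℂ) :
    vertex₁ x e (adMat τ X) = current x e (adMat τ X) :=
  vertex₁_eq_current x e (adMat_transpose τ X)

/-- and for the vector copies `A ⊗ 1_D`. [folklore] -/
theorem vertex₁_adMat_copies (D : Type*) [Fintype D] [DecidableEq D] (x e : Λ) (τ : C → Matrix (Fin N) (Fin N) ℂ)
    (X : Matrix (Fin N) (Fin N) ℂ) : vertex₁ x e (copies D (adMat τ X)) = current x e (copies D (adMat τ X)) :=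
  vertex₁_eq_current x e (copies_skew D (adMat_transpose τ X))

/-- **THE GHOST POLARIZATION IN CELL FORM, GENERAL `N`**: between the bond `(z, e)` twisted by `τ_a` and the bond `(z + v + e, e′)`
twisted by `τ_a`, through an even colour-diagonal propagator, `−trace(G J G J′) = 2·(2N²)·cellForm g e e′ v`. [folklore] -/
theorem polarization_ghost_gen (hτ : Complete τ) (ho : TrOrthonormal τ) (hH : ∀ c, (τ c).IsHermitian) (hN : N ≠ 0)
    {g : Λ → ℝ} (hg : ∀ v, g (-v) = g v) (z v e e' : Λ) (a : C) :
    -Matrix.trace (convKernel g * current z e (adMat τ (τ a)) * (convKernel g * current (z + (v + e)) e' (adMat τ (τ a)))) =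
      2 * (2 * (N : ℝ) ^ 2) * cellForm g e e' v := by
  rw [bubble_current_cell hg, trace_adMat_gen_sq hτ ho hH hN]
  ring

/-- colour-off-diagonal pairs `a ≠ b` give zero (`Π^{ab} = δ^{ab}Π`, B12 (1.21)). [folklore] -/
theorem polarization_ghost_gen_offdiag (hτ : Complete τ) (ho : TrOrthonormal τ) (hH : ∀ c, (τ c).IsHermitian) (hN : N ≠ 0)
    {g : Λ → ℝ} (hg : ∀ v, g (-v) = g v) (z v e e' : Λ) {a b : C} (hab : a ≠ b) :
    Matrix.trace (convKernel g * current z e (adMat τ (τ a)) * (convKernel g * current (z + (v + e)) e' (adMat τ (τ b)))) = 0 := by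
  rw [bubble_current_cell hg, trace_adMat_gen hτ ho hH hN, if_neg hab]
  ring

/-- **THE VECTOR-LAPLACIAN SECTOR, GENERAL `N`**: with the copies `A_a ⊗ 1_D` the same polarization is `card D` times the ghost one,
`−trace(G J G J′) = 2·(card D·2N²)·cellForm g e e′ v`. [folklore] -/
theorem polarization_vector_gen (D : Type*) [Fintype D] [DecidableEq D] (hτ : Complete τ) (ho : TrOrthonormal τ)
    (hH : ∀ c, (τ c).IsHermitian) (hN : N ≠ 0) {g : Λ → ℝ} (hg : ∀ v, g (-v) = g v) (z v e e' : Λ) (a : C) :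
    -Matrix.trace (convKernel g * current z e (copies D (adMat τ (τ a))) *
        (convKernel g * current (z + (v + e)) e' (copies D (adMat τ (τ a))))) =
      2 * (Fintype.card D * (2 * (N : ℝ) ^ 2)) * cellForm g e e' v := by
  rw [bubble_current_copies_cell D hg, trace_adMat_gen_sq hτ ho hH hN]
  ring

/-- **ON `ℤ⁴`: the general-`N` ghost table is `ghostCoeff (2N²)` with the constant read off the group**:
`lattBubble (ghostCoeff (−trace(A_aA_a))) = 2·(2N²)·cellForm gFree e_μ e_ν`. [folklore] -/
theorem lattBubble_ghost_gen {μ ν : Fin 4} (hμν : μ ≠ ν) (hτ : Complete τ) (ho : TrOrthonormal τ)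
    (hH : ∀ c, (τ c).IsHermitian) (hN : N ≠ 0) (a : C) (L k : ℕ) (v : Pt) :
    lattBubble Finset.univ (ghostCoeff (-Matrix.trace (adMat τ (τ a) * adMat τ (τ a)))) (ghostP μ) (ghostQ hμν) L k v =
      2 * (2 * (N : ℝ) ^ 2) * cellForm gFree (unitVec μ) (unitVec ν) v := by
  rw [trace_adMat_gen_sq hτ ho hH hN, neg_neg, lattBubble_ghost]

/-- **`hval` OF THE GENERAL-`N` GHOST TABLE, CONSTANT COMPUTED FROM THE GROUP**: `τ = −trace(A_aA_a) = 2N²` ⟹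
`x_μx_ν·contBubble = leadingIntegrand (kappaBal N / 11) μ ν x` for every complete tr-orthonormal Hermitian generator family and
every `N ≠ 0` (the `su(2)` case `hval_ghost_su2` is `τ = pauli`, up to the basis identification). [folklore] -/
theorem hval_ghost_gen {μ ν : Fin 4} (hμν : μ ≠ ν) (hτ : Complete τ) (ho : TrOrthonormal τ)
    (hH : ∀ c, (τ c).IsHermitian) (hN : N ≠ 0) (a : C) :
    ∀ x : E4, x ≠ 0 → x μ * x ν *
        contBubble Finset.univ (ghostCoeff (-Matrix.trace (adMat τ (τ a) * adMat τ (τ a)))) (ghostP μ) (ghostQ hμν) x =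
      leadingIntegrand (kappaBal N / 11) μ ν x := by
  rw [trace_adMat_gen_sq hτ ho hH hN, neg_neg]
  exact hval_ghost_bal hμν N

/-- CONSISTENCY OF THE TWO `su(2)` COMPUTATIONS: §8's explicit `adPauli a` IS `ColourTrace.adMat` of the Pauli family at `σ_a`
(entry `(c,d)` = `−2ε_{adc}` on both sides). [folklore] -/
theorem adPauli_eq_adMat (a : Fin 3) :
    adPauli a = adMat Literature.MathematicalPhysics.QuantumFieldTheory.Balaban1983to89.Beta.ColourTrace.pauli
      (Literature.MathematicalPhysics.QuantumFieldTheory.Balaban1983to89.Beta.ColourTrace.pauli a) := by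
  ext c d
  fin_cases a <;> fin_cases c <;> fin_cases d <;>
    simp [adPauli, lc, adMat, Literature.MathematicalPhysics.QuantumFieldTheory.Balaban1983to89.Beta.ColourTrace.adMatC,
      Literature.MathematicalPhysics.QuantumFieldTheory.Balaban1983to89.Beta.ColourTrace.ntr,
      Literature.MathematicalPhysics.QuantumFieldTheory.Balaban1983to89.Beta.ColourTrace.ibr,
      Literature.MathematicalPhysics.QuantumFieldTheory.Balaban1983to89.Beta.ColourTrace.pauli,
      Matrix.trace, Matrix.mul_apply, Fin.sum_univ_two] <;> norm_num

end GeneralN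

/-! ## Examples -/

section Examples

/-- On the two-site torus `ZMod 2` with one colour and `A = 0`-free data: the contact vertex of the twist by the `1 × 1`
matrix `a` is `a²` at the far endpoint. [folklore] -/
example (x e : ZMod 2) (a : ℝ) :
    vertex₂ (C := Unit) x e (Matrix.of fun _ _ => a) = elemIns (x + e) (x + e) (Matrix.of fun _ _ => a * a) := by
  rw [vertex₂_eq]
  congr 1
  ext i j
  simp [Matrix.mul_apply]

/-- The cell identity on `ℤ` with `e = e′ = 1`: `g(0)g(2) − g(1)² = g(0)(g(2) − 2g(1) + g(0)) − (g(1) − g(0))²`. [folklore] -/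
example (g : ℤ → ℝ) : g 0 * g (0 + 1 + 1) - g (0 + 1) * g (0 + 1) = cellForm g 1 1 0 := cell_identity g 1 1 0

/-- The ghost constant at `N = 2`: `8c₄²/3 = kappaBal 2/11`. [folklore] -/
example : 2 * (2 : ℝ) ^ 2 * c4 ^ 2 / 3 = kappaBal 2 / 11 := kappa_ghost_eq 2

/-- `[σ¹, σ²] = 2iσ³` as an instance of `pauli_comm`. [folklore] -/
example : pauli 0 * pauli 1 - pauli 1 * pauli 0 = (2 * Complex.I) • pauli 2 := by
  rw [pauli_comm, Fin.sum_univ_three]; simp [lc]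

/-- The four vector copies of the `su(2)` ghost colour matrix have colour trace `4·(−8) = −32`. [folklore] -/
example (a : Fin 3) : Matrix.trace (copies (Fin 4) (adPauli a) * copies (Fin 4) (adPauli a)) = -32 := by
  rw [trace_copies_mul, trace_adPauli_sq]; norm_num

end Examples

end Literature.MathematicalPhysics.QuantumFieldTheory.Balaban1983to89.Beta.GhostTable
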